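import Summits.HodgeConjecture.HodgeConjecture.Theorems.F0HFOfSiegelModuli   -- ★ p807780 `…Theorems.F0HFOfSiegelModuli.hF_holds : F0FloorSockets.HFType` (socket (F) is a theorem)
import Summits.HodgeConjecture.HodgeConjecture.Theses.HCCMUnconditional      -- route file rev 1 (R2, commit 7a24856f3f6c): `def F0HF : Prop := …F0FloorSockets.HFType` = item stmt-HodgeConjecture-27454
import HarnessLib

/-!
# FLOOR-0 support item `F0HF` (stmt-HodgeConjecture-27454) CLOSED — `F0HF_holds : Theses.HCCMUnconditional.F0HF`

Cell `hodgecm-mathlib`, programme HC_CM FLOOR 0 (D-0183), programme P1 (moduli).  HONEST LABEL: HC_CM is proved only modulo the 7 printed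
citations until rung 0 closes; THIS file discharges floor input I-1 ONLY — the route's support decl `F0HF` (R2, director g14 s386∕s423∕s426:
`def F0HF : Prop := Summit.HodgeConjecture.HodgeConjecture.Theorems.F0FloorSockets.HFType`, the binder `hF` of ★ `hc_cm_of_generic_floor_v7`),
i.e. the printed existence statement [Lan2013PELCompactifications, Thm. 1.4.1.11 + Cor. 7.2.3.9] ∕ [MumfordFogartyKirwan1994, Thm. 7.9 ∕ 7.10]
typed as ★ `lan2013_siegelFineModuliScheme`, now a THEOREM on Mathlib + the ★ Literature ∕ Theorems files (axioms = the Lean trio) by ★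
`Theorems/F0HFOfSiegelModuli.hF_holds` (the P1 head line `Cruxes/HDel/Lines/F0_SiegelModuli.lean` re-homed over its four ★ cores II ∕ F3 ∕ PL ∕ F11).
One closer per item (s418): this file closes `F0HF` only; the crux decl `HDel` (item 24835) is closed by `Theorems/HCCMUnconditionalHDelOfF0.lean`.
0 `def`, 0 `sorry`; one theorem whose TYPE is the route decl BY NAME (the gate's identity check).  Filer: B-p01 (g17) (s418 «socket hF»).
-/

-- the mandated namespace has the single-problem summit's repeated segment (`HodgeConjecture.HodgeConjecture`)
set_option linter.dupNamespace false

namespace Summit.HodgeConjecture.HodgeConjecture.Theorems.HCCMUnconditionalF0HFOfSiegelModuli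

/-- **FLOOR-0 support item `F0HF` holds** — the route decl `Summit.HodgeConjecture.HodgeConjecture.Theses.HCCMUnconditional.F0HF`
(`:= F0FloorSockets.HFType := lan2013_siegelFineModuliScheme`) BY NAME, from ★ `F0HFOfSiegelModuli.hF_holds`.
[cite: Lan2013PELCompactifications, Thm. 1.4.1.11 (p. 91) and Cor. 7.2.3.9 (p. 518)]
[cite: MumfordFogartyKirwan1994, Ch. 7 §3 Theorem 7.9 with the remark following it and Theorem 7.10 (p. 139)] -/
theorem F0HF_holds : Summit.HodgeConjecture.HodgeConjecture.Theses.HCCMUnconditional.F0HF :=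
  Summit.HodgeConjecture.HodgeConjecture.Theorems.F0HFOfSiegelModuli.hF_holds

end Summit.HodgeConjecture.HodgeConjecture.Theorems.HCCMUnconditionalF0HFOfSiegelModuli
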